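import Summits.BirchSwinnertonDyer.Rank1Residual.O5.SignedLevelRaisingTransferThree
import HarnessLib

/-!
# The Mordell–Weil shadow of the second reciprocity law at `p = 3` (o5-r2 GEN 15, census RECIP3)

PLACEMENT (typer of record cc-typer-5 GEN 16; o5-r2 GEN 15 widened ask A-O5-G15-1, HOME/INBOX.md RESULT G-35 2026-08-22T14:50:56Z l.12338
'place SecondReciprocityThree.lean with DepthLawThree.lean … under O5/'; DOCKETED by cc-lead ⟦gen63⟧ (2′)(ix) as (c27b), conditions (A)–(G)):
(A) source FROZEN `HOME/b2b-bsdres-o5-r2/gen15/lean/SecondReciprocityThree.lean` sha16 `bcd96b3dbb2687f4` (125 l.; the INBOX sha is the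
freeze of record; re-hashed by cc-lead 14:51Z and by the typer = MATCH; `lean check` rc 0 / 0 sorries / 0 warnings re-run by the typer);
(B) ALL decl blocks byte-identical (2 `@[conjecture]` THEOREM-CANDIDATE nodes `SecondReciprocityShadowThree` (3 clauses) /
`TwoPrimeSelmerBitThree` over the tree's own `LocallyThreeDivisibleAt` / scope binders of `SignedLevelRaisingTransferThree`) — typer edits
= this paragraph only; (E) `@[conjecture]` × 2 = the source's, sorry 0, 0 Literature facts, net named-fact debt 0.  (D) EVIDENCE FRAMING:
census RECIP3 (pre-registration `gen15/recip3/RECIP3-PREREG.md` 786103d934968314 BEFORE any id — census-lead PRE-ENTRY gate HOME/INBOX.md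
l.12333 'MET, inputs 6 / 6 sha reproduce'; kit j164932 16 527 / 16 527 rows, 0 ERR, R-1…R-4 / I-1…I-3 0 exceptions; census-lead RESULT READ
l.12344 (requests l.3001): cell-for-cell = the seat, registered rule 0 exceptions ⇒ 'RECIP3 SURVIVES on this census (EVIDENCE; 13 623
registered instances)', WEIGHT per the seat's own POST-HOC NOTE — quoted verbatim below, not softened: the census validates the clean-pair
matching + pipeline end to end and the nodes are cheap PROVER TARGETS in class KC₃; it is NOT evidence for the value-level law) = EVIDENCE,
never a Literature fact; no hypothesis-free per-curve BSD decl; nothing is imported into a class row by this landing; RECIP3 is a DIFFERENT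
law from R1♯ (`O5/DepthLawThree.lean`, (c27a)) and from S1 (`O5/CoordinateLagrangianLemma.lean`, PROVED, cc-eng-5 GEN 43).  (F) o5-r2's
TARGETS §O5 'o5-r2 GEN 15' note stands, quoted not re-worded: 'CONVERGED §O5 UNCHANGED'.  LANE CLASS-CLOSURE: research route; census
numbers = EVIDENCE; nothing booked; no mark of `RESIDUAL-MAP.md` moves; O5 OPEN.

HONEST FRAMING: research route (non-Iwasawa class O5 programme, technique class KC₃ = signed Kolyvagin classes at
`p = 3`); every node below is an `@[conjecture] def … : Prop` — a THEOREM-CANDIDATE with a written derivation, NOT a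
Literature fact, nothing asserted, net named-fact debt `0`.  Census output is EVIDENCE only.

## Setting
`C/ℚ` globally minimal with `C[3]` irreducible, two Kolyvagin-type primes `q₁ ≠ q₂`, `qᵢ ≡ 2 (mod 3)`, `qᵢ ∤ N_C`,
`a_{qᵢ}(C) ≡ qᵢ + 1 ≡ 0 (mod 3)`, and the two single-prime level raisings `G₁` (conductor `N_C q₁`, split
multiplicative at `q₁`) and `G₂` (conductor `N_C q₂`, split at `q₂`), both congruent to `C` mod `3` and CLEAN
(scope binders verbatim from `SignedLevelRaisingTransferThree` / `TwoPrimeTransferThree`).  Inside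
`H¹(ℚ, ρ̄)`, `ρ̄ = C[3] ≅ Gᵢ[3]`, write `κᵢ` for the Kummer class of a generator of `Gᵢ(ℚ)` that is not a class of
`C`.  At `qᵢ` the local cohomology `H¹(ℚ_{qᵢ}, ρ̄)` is 2-dimensional and is the direct sum of two complementary
LAGRANGIAN lines: `F` (unramified = Kummer image of the good curve) and `T` (ramified = Kummer image of the split Tate
curve); the local Tate pairing restricts to a perfect pairing `F × T → 𝔽₃`.

## The law and its proof sketch (duality level)
SECOND RECIPROCITY (Bertolini–Darmon 2005 Thm 4.1-shape; Howard 2006 bipartite Euler systems; here `p = 3` and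
`q ≡ −1 (mod 3)`, where no bipartite Euler system is in print): `loc_{q₂} κ₁` and `loc_{q₁} κ₂` are both "equal to
`λ(q₁q₂)`".  Its VANISHING-LEVEL shadow `loc_{q₂} κ₁ = 0 ↔ loc_{q₁} κ₂ = 0` is FORCED by global duality: for the two
global classes `κ₁, κ₂ ∈ H¹(ℚ, ρ̄)` the sum of local cup-product invariants vanishes (Poitou–Tate), every place
`v ∉ {q₁, q₂}` contributes `0` (both classes lie in the common Lagrangian local condition — this is exactly the
CLEAN-PAIR matching, at `3` included), so `⟨loc_{q₁}κ₁, loc_{q₁}κ₂⟩_{q₁} = −⟨loc_{q₂}κ₁, loc_{q₂}κ₂⟩_{q₂}` with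
`loc_{q₁}κ₁ ∈ T ∖ 0`, `loc_{q₁}κ₂ ∈ F`, `loc_{q₂}κ₁ ∈ F`, `loc_{q₂}κ₂ ∈ T ∖ 0` (non-vanishing: else `κᵢ ∈ Sel₃(C)`,
excluded by the rank / `Ш(C)[3] = 0` hypotheses); perfectness of `F × T` turns each side into "the `F`-component
vanishes", whence `loc_{q₂}κ₁ = 0 ↔ loc_{q₁}κ₂ = 0`.  In Mordell–Weil terms (`Ш(Gᵢ)[3] = 0` where needed):
`DIV_{q₂}(G₁) ↔ DIV_{q₁}(G₂)` (`LocallyThreeDivisibleAt`).  The same argument with the Greenberg–Wiles count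
`dim Sel^{rel q₁q₂} = 2` decides the two-prime Selmer dimension: `dim Sel₃(G₁₂) = 2·[DIV_{q₂}(G₁)]` for the double
level raising `G₁₂` — sharpening clause 3 of `TwoPrimeTransferThree` (`∈ {0, 2}`) to an explicit bit.
Named inputs a prover needs (none vendored here): Poitou–Tate sum formula for `H¹(ℚ, C[3])` (Neukirch–Schmidt–Wingberg,
Cohomology of Number Fields, (8.1.17)/(8.6.x)); local conditions at a Kolyvagin prime (Gross–Parson 2011 Lemma 8 as cited
by W. Zhang 2014 Lemma 4.2); clean-pair matching at `3` (Raynaud `e = 1 < p − 1` for pairs good at `3`; the tree's T24ℓ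
for `ClassO5`).

## Evidence
[evidence: census RECIP3, o5-r2 GEN 15, kit j164932 (prereg RECIP3-PREREG.md 786103d934968314, PRE-ENTRY before any job
id): 16 527 pairs of single-prime split Kolyvagin-type level raisings of 2 837 base classes (all GOOD at 3; GEN 11 JPCAL
CAL1 population), 0 ERR — R-1 (r_C = 0): DIV_{q₂}(G₁) = DIV_{q₁}(G₂) on 10 561 / 10 561 (cells (0,0) 7 255, (1,1) 3 306,
off-diagonal 0); R-4 (r_C = 1, both depths ≥ 1, both Gᵢ rank 2 unit): 517 / 517 ((0,0) 388, (1,1) 129); R-3 (one-sided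
propagation): 2 529 / 2 529; R-2 (two-prime partner G₁₂ known, CAL2): dim-jump = 2δ on 16 / 16; exploratory: rate of
δ = 1 is 0.3130 (4 924 / 15 732 distinct incidences; naive Chebotarev 1/3), depth-≥2 coincidences 19 vs 22.8 expected
under independence (no 9-adic shadow without a mod-9 congruence, as the derivation predicts).]
POST-HOC NOTE (written after the run): since the vanishing-level shadow is a CONSEQUENCE of duality given the clean-pair
matching, the 0-exception census is best read as an end-to-end validation of that matching and of the pipeline on
13 623 registered instances, and the nodes below as cheap PROVER TARGETS; the value-level content of the law
(`λ(q₁q₂)` as an element, levels `3^k`, `k ≥ 2`) is not tested by it.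
-/

noncomputable section

open scoped Classical

open WeierstrassCurve Literature.NumberTheory.EllipticCurves Literature.NumberTheory.EllipticCurves.Rank1Residual
  Summit.BirchSwinnertonDyer.Rank1Residual.Additive

namespace Summit.BirchSwinnertonDyer.Rank1Residual.O5

/-- **`SecondReciprocityShadowThree` (THEOREM-CANDIDATE, o5-r2 GEN 15; proof sketch: module docstring — Poitou–Tate sum
formula + complementary Lagrangians `F ⊕ T` at a Kolyvagin prime).**  For a clean mod-3 congruent TRIPLE `(C; G₁, G₂)`
— `Gᵢ` the split level raising of `C` at the Kolyvagin-type prime `qᵢ ≡ 2 (mod 3)` — three clauses: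
(1) `r(C) = 0`, `Ш(C)[3] = 0`, `r(Gᵢ) = 1`: `DIV_{q₂}(G₁) ↔ DIV_{q₁}(G₂)`;
(2) `r(C) = 1`, `Ш(C)[3] = 0`, `C(ℚ) ⊂ 3C(ℚ_{qᵢ})` for both `i`, `r(Gᵢ) = 2`, `Ш(Gᵢ)[3] = 0`: `DIV_{q₂}(G₁) ↔ DIV_{q₁}(G₂)`;
(3) propagation (no duality needed): `r(C) = 1`, `Ш(C)[3] = 0`, `C(ℚ) ⊄ 3C(ℚ_{q₁})`, `C(ℚ) ⊂ 3C(ℚ_{q₂})`, `r(G₂) = 2`,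
`Ш(G₂)[3] = 0`: `G₂(ℚ) ⊄ 3G₂(ℚ_{q₁})`.
Why it might fail: only through the clean-pair identification of local conditions (at `3`: Raynaud for pairs good at `3`,
T24ℓ for `ClassO5`), i.e. exactly where `SignedLevelRaisingTransferThree` could.  SCOPE binder `ClassO5 C 3 ∨ ¬ Addv C 3`
as for T-O5-JP.
[evidence: census RECIP3, o5-r2 GEN 15, kit j164932: clause (1) 10 561 / 10 561, clause (2) 517 / 517, clause (3) 2 529 / 2 529, 0 exceptions; all base classes good at 3]
[cite: BertoliniDarmon2005, Thm 4.1 (second explicit reciprocity law, shape only); WZhang2014, Lemma 4.2 (p. 217)] -/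
@[conjecture] def SecondReciprocityShadowThree : Prop :=
  ∀ (C G₁ G₂ : WeierstrassCurve ℚ) [C.IsElliptic] [C.IsGloballyMinimal] [G₁.IsElliptic] [G₁.IsGloballyMinimal]
    [G₂.IsElliptic] [G₂.IsGloballyMinimal] (q₁ q₂ : ℕ) (hq₁ : q₁.Prime) (hq₂ : q₂.Prime),
    q₁ ≠ q₂ → q₁ % 3 = 2 → q₂ % 3 = 2 →
    C.HasIrreducibleModPGaloisRep 3 → IsCongruentModThree C G₁ → IsCongruentModThree C G₂ →
    (ClassO5 C 3 ∨ ¬ Addv C 3) →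
    ¬ (q₁ ∣ C.conductorNorm ℤ) → ¬ (q₂ ∣ C.conductorNorm ℤ) →
    G₁.conductorNorm ℤ = C.conductorNorm ℤ * q₁ → G₂.conductorNorm ℤ = C.conductorNorm ℤ * q₂ →
    @IsSplitNodeAt G₁ q₁ ⟨hq₁⟩ → @IsSplitNodeAt G₂ q₂ ⟨hq₂⟩ →
    transversePrimesThree C = ∅ → transversePrimesThree G₁ ⊆ {q₁} → transversePrimesThree G₂ ⊆ {q₂} →
    @NoLocalThreeTorsionAt C 3 ⟨Nat.prime_three⟩ → @NoLocalThreeTorsionAt G₁ 3 ⟨Nat.prime_three⟩ →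
    @NoLocalThreeTorsionAt G₂ 3 ⟨Nat.prime_three⟩ →
    C.rootNumberThree = G₁.rootNumberThree → C.rootNumberThree = G₂.rootNumberThree →
    C.ShaFinite → ¬ (3 ∣ C.shaOrder) →
      (C.mordellWeilRank = 0 → G₁.mordellWeilRank = 1 → G₂.mordellWeilRank = 1 →
          (@LocallyThreeDivisibleAt G₁ q₂ ⟨hq₂⟩ ↔ @LocallyThreeDivisibleAt G₂ q₁ ⟨hq₁⟩)) ∧
      (C.mordellWeilRank = 1 → @LocallyThreeDivisibleAt C q₁ ⟨hq₁⟩ → @LocallyThreeDivisibleAt C q₂ ⟨hq₂⟩ →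
          G₁.mordellWeilRank = 2 → G₂.mordellWeilRank = 2 →
          G₁.ShaFinite → ¬ (3 ∣ G₁.shaOrder) → G₂.ShaFinite → ¬ (3 ∣ G₂.shaOrder) →
          (@LocallyThreeDivisibleAt G₁ q₂ ⟨hq₂⟩ ↔ @LocallyThreeDivisibleAt G₂ q₁ ⟨hq₁⟩)) ∧
      (C.mordellWeilRank = 1 → ¬ @LocallyThreeDivisibleAt C q₁ ⟨hq₁⟩ → @LocallyThreeDivisibleAt C q₂ ⟨hq₂⟩ →
          G₂.mordellWeilRank = 2 → G₂.ShaFinite → ¬ (3 ∣ G₂.shaOrder) →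
          ¬ @LocallyThreeDivisibleAt G₂ q₁ ⟨hq₁⟩)

/-- **`TwoPrimeSelmerBitThree` (THEOREM-CANDIDATE, o5-r2 GEN 15; sharpens clause 3 of `TwoPrimeTransferThree`).**
For `r(C) = 0`, `Ш(C)[3] = 0`, the single level raising `G₁` at `q₁` and the DOUBLE level raising `G₁₂` (conductor
`N_C q₁ q₂`, split at both Kolyvagin-type primes), all clean and congruent mod `3`:
`dim_{𝔽₃} Sel₃(G₁₂) = 2` iff `DIV_{q₂}(G₁)`, and `= 0` otherwise (proof sketch: `Sel^{rel q₁q₂}(ρ̄) = ⟨κ₁, κ₂⟩` by the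
Greenberg–Wiles count, and `x = uκ₁ + vκ₂` satisfies the transverse conditions at both primes iff `v·loc_{q₁}κ₂|_F = 0`
and `u·loc_{q₂}κ₁|_F = 0`).  Why it might fail: as `SecondReciprocityShadowThree`.
[evidence: census RECIP3 cell R-2, o5-r2 GEN 15, kit j164932: the 16 pairs with a known CAL2 partner G₁₂ (< 500 000): (rank, 3 ∤ Ш_an)(G₁₂) = (2·δ, unit) on 16 / 16 (δ = 1: 10, rank 2; δ = 0: 6, rank 0)]
[cite: WZhang2014, Lemma 4.2 (p. 217) and Prop. 5.4 (p. 225)] -/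
@[conjecture] def TwoPrimeSelmerBitThree : Prop :=
  ∀ (C G₁ G : WeierstrassCurve ℚ) [C.IsElliptic] [C.IsGloballyMinimal] [G₁.IsElliptic] [G₁.IsGloballyMinimal]
    [G.IsElliptic] [G.IsGloballyMinimal] (q₁ q₂ : ℕ) (hq₁ : q₁.Prime) (hq₂ : q₂.Prime),
    q₁ ≠ q₂ → q₁ % 3 = 2 → q₂ % 3 = 2 →
    C.HasIrreducibleModPGaloisRep 3 → IsCongruentModThree C G₁ → IsCongruentModThree C G →
    (ClassO5 C 3 ∨ ¬ Addv C 3) →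
    ¬ (q₁ ∣ C.conductorNorm ℤ) → ¬ (q₂ ∣ C.conductorNorm ℤ) →
    G₁.conductorNorm ℤ = C.conductorNorm ℤ * q₁ → G.conductorNorm ℤ = C.conductorNorm ℤ * q₁ * q₂ →
    @IsSplitNodeAt G₁ q₁ ⟨hq₁⟩ → @IsSplitNodeAt G q₁ ⟨hq₁⟩ → @IsSplitNodeAt G q₂ ⟨hq₂⟩ →
    transversePrimesThree C = ∅ → transversePrimesThree G₁ ⊆ {q₁} → transversePrimesThree G ⊆ {q₁, q₂} →
    @NoLocalThreeTorsionAt C 3 ⟨Nat.prime_three⟩ → @NoLocalThreeTorsionAt G₁ 3 ⟨Nat.prime_three⟩ →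
    @NoLocalThreeTorsionAt G 3 ⟨Nat.prime_three⟩ →
    C.rootNumberThree = G₁.rootNumberThree → C.rootNumberThree = G.rootNumberThree →
    C.ShaFinite → ¬ (3 ∣ C.shaOrder) → C.mordellWeilRank = 0 → G₁.mordellWeilRank = 1 →
      (@LocallyThreeDivisibleAt G₁ q₂ ⟨hq₂⟩ → selmerDimThree G = 2) ∧
      (¬ @LocallyThreeDivisibleAt G₁ q₂ ⟨hq₂⟩ → selmerDimThree G = 0)

end Summit.BirchSwinnertonDyer.Rank1Residual.O5

end
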